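import Literature.Computability.AlgebraicComplexity.GKKP11Thm3Proofs
import Literature.Computability.AlgebraicComplexity.GKKP11Thm4Proofs
import Mathlib.Analysis.Complex.Polynomial.Basic
import Mathlib.Analysis.Real.Sqrt
import HarnessLib

/-!
# Proof of the sharpened bounds after GKKP 2011, Theorem 3 (discharge of the named facts
`GKKP2011_thm3_sharp_complex`, `GKKP2011_thm3_sharp_real`)

[cite: GrenetEtAl2011, §2.2 (after Thm 3)] — B. Grenet, E. L. Kaltofen, P. Koiran, N. Portier,
*Symmetric determinantal representation of weakly-skew circuits*, STACS 2011 / arXiv:1007.3804,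
§2.2, the unnumbered sharpening after Theorem 3 (held text `paper:arxiv-1007.3804`,
p0010:L55): "The bound obtained in Theorem 3 can be sharpened when `k = ℝ` or `ℂ`. The idea is
to build `Ḡ` by merging `s` and `t` instead of adding a new vertex. Suppose that `φ` has at
least one addition gate … the new bound is `2e+1` [over `ℂ`] … if `k` is the field of real
numbers, it is sufficient to add a new vertex with a loop of weight `-1` … to get the bound
`2e+2`."

`GKKP2011_thm3_sharp_complex_holds : GKKP2011_thm3_sharp_complex` and
`GKKP2011_thm3_sharp_real_holds : GKKP2011_thm3_sharp_real` (statements in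
`GKKP11SymmetricRepresentations.lean`): a formula with an addition gate and green size `e` is
`det` of a symmetric matrix of dimension `≤ 2e+1` over `ℂ` (`≤ 2e+2` over `ℝ`) with entries
inputs of the formula or constants.

## The proof (the printed idea, with a repaired bookkeeping of the constants)

We follow the printed IDEA — merge `s` and `t` of the graph of Theorem 3 into one vertex `s`, so
that the layout has `2·(#pairs) + 1` vertices, and over `ℝ` allow one extra vertex with a loop
`-1` — but NOT the printed one-line recipe ("multiply the weights of `t₂u` and `ut₁` by
`w = √(|c₀|/2)`"), which does not survive merging literally: after merging, every closed walk
through `s` is counted twice in the determinant (once per direction) while the direct edge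
`s – t`, now a loop, is counted once — for `φ = x + y` the printed matrix
`[[x, y, -w],[y, 0, w],[-w, w, 0]]` has determinant `-w²(x + 2y)` (observation recorded on the
cell bus by seat val-lit-p8, 2026-08-26). The repaired constants bookkeeping, which is this file's
contribution (all in the spirit of GKKP's "how to have the constants for free"):

* `Thm3Sharp.det_loopLayout`: the merged layout `s ⊕ (in-copies ⊕ out-copies)` with a loop `μ` at
  `s` has `det = (-1)^{|V|}·det(X)²·(μ - 2·(aX⁻¹)·b)` (Schur complement, as in Theorems 2–4).
* `Thm3Sharp.exists_summands`: a formula is a sum of scaled TOP-LEVEL SUMMANDS `Σ c_i T_i`, each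
  `T_i` a leaf or a product of two non-constant-input formulas, with
  `#summands + Σ gsize(T_i) ≤ gsize(φ) + 1` (Def. 6: additions and multiplications by constant
  inputs are absorbed) — and, when `φ` has an addition gate, at least two summands or a product
  summand.
* `Thm3Sharp.exists_sinkBranch`: each summand is realised by GKKP's two-terminal graph with
  constants (`Thm3.exists_signedABP`, the engine of Theorem 3, from `GKKP11Thm3Proofs.lean`)
  whose SINK becomes one more matched pair `τ` (the direct edge goes to `s – τ_in`) with a single
  constant out-edge `τ_out – s`: its weight absorbs both the factor `2` of the merged layout and
  the constant `c₀` of the engine, summand by summand (`Thm3Sharp.exists_assembly` glues the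
  branches at `s`). Cost: `gsize(T_i) + 1` pairs per summand, one pair too many in total;
* the saved pair: (A) a nonzero PRODUCT summand `ψ₁ × ψ₂` is realised instead by the series
  composition of the engines of `ψ₁`, `ψ₂` (`Thm3Sharp.exists_seriesBranch`, Lemma 3's product
  gadget) whose series LINK carries a constant weight `l` solving a linear equation (`det` picks
  up `l²`, the closed-walk sum `l⁻¹`); (B) else a CONSTANT summand becomes the loop `μ` at `s`;
  (C) else all summands are nonzero multiples `c_i x_i` of variables (and there are `≥ 2`): `x_1`
  becomes the loop at `s` and the link of the branch of `x_2` carries `l` with `l² = ±c_1` — this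
  is where the field matters, exactly as printed: over `ℂ` a square root always exists
  (`IsAlgClosed.exists_eq_mul_self`), over `ℝ` either `l = √(±c_1)` works or the extra vertex
  with the loop `-1` flips the sign (`Thm3Sharp.exists_layout`, dimension `2e+2`).
  (`Thm3Sharp.sharp_core` runs the three cases over any field of characteristic `≠ 2` with the
  needed square roots as a hypothesis.)

No new definitions, no new named facts (D-0026): theorems only. Honest framing: bookkeeping for rung V1 of the `ValiantsHypothesis` ladder (symmetric
determinantal representations of formulas); `VP ≠ VNP` is NOT proved and nothing here is
progress on it.
-/

noncomputable section

open Matrix MvPolynomial Finset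

namespace Literature.Computability.AlgebraicComplexity

namespace GKKP2011

namespace Thm3Sharp

/-! ## Part I. Matrix algebra: the merged layout (one special vertex `s` with a loop) -/

section Algebra

variable {R : Type*} [CommRing R] {V : Type*} [Fintype V] [DecidableEq V]

/-- **The merged layout `s = t`.** Vertices `s ⊕ (in-copies ⊕ out-copies)`: a loop `μ` at `s`,
edges `s – in` of weights `a`, `s – out` of weights `h`, the bipartite middle `[[0, Xᵀ],[X, 0]]`.
Schur complement: `det = (-1)^{|V|} · det(X)² · (μ - 2 · (a X⁻¹) · h)` — every closed walk through
`s` is counted twice (once per direction), the loop once. [cite: GrenetEtAl2011, §2.2 (after Thm 3)] -/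
theorem det_loopLayout (X G : Matrix V V R) (hG : X * G = 1) (a h : V → R) (μ : R) :
    (Matrix.fromBlocks (Matrix.of fun (_ _ : Unit) => μ) (Matrix.of fun _ => Sum.elim a h)
      (Matrix.of fun uv (_ : Unit) => Sum.elim a h uv) (Matrix.fromBlocks 0 Xᵀ X 0)).det =
      (-1) ^ Fintype.card V * X.det ^ 2 * (μ - 2 * ((a ᵥ* G) ⬝ᵥ h)) := by
  have hmid : Matrix.fromBlocks 0 Xᵀ X 0 = midBlock (X - 1) := by
    simp [midBlock, transpose_sub, transpose_one]
  have hG' : (1 + (X - 1)) * G = 1 := by rwa [add_sub_cancel]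
  letI : Invertible (midBlock (X - 1)) :=
    invertibleOfRightInverse _ _ (midBlock_mul_midInv (X - 1) G hG')
  have hinv : ⅟(midBlock (X - 1)) = midInv G := invOf_eq_right_inv (midBlock_mul_midInv _ G hG')
  have hGX : G * X = 1 := mul_eq_one_comm.1 hG
  have hdetmid : (midBlock (X - 1)).det = (-1) ^ Fintype.card V * X.det ^ 2 := by
    have hfac : midBlock (X - 1) =
        Matrix.fromBlocks 1 (-G) 0 1 * Matrix.fromBlocks 1 Xᵀ X 0 := by
      rw [← hmid, fromBlocks_multiply]
      simp [hGX]
    rw [hfac, det_mul, det_fromBlocks_zero₂₁, det_one, one_mul, one_mul, det_fromBlocks_one₁₁,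
      zero_sub, ← neg_mul, det_mul, det_transpose, det_neg, mul_assoc, ← pow_two]
  have hschur : (Matrix.of fun (_ : Unit) => Sum.elim a h) * midInv G *
      (Matrix.of fun uv (_ : Unit) => Sum.elim a h uv) =
      Matrix.of fun (_ _ : Unit) => 2 * ((a ᵥ* G) ⬝ᵥ h) := by
    have hT : (Matrix.of fun uv (_ : Unit) => Sum.elim a h uv) =
        (Matrix.of fun (_ : Unit) => Sum.elim a h)ᵀ := rfl
    rw [hT]
    ext i j
    rw [mul_mul_transpose_apply]
    have hq : ∑ x : V, ∑ y : V, a x * G x y * h y = (a ᵥ* G) ⬝ᵥ h := by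
      simp only [vecMul, dotProduct, Finset.sum_mul]
      rw [Finset.sum_comm]
    have hq' : ∑ x : V, ∑ y : V, h x * G y x * a y = (a ᵥ* G) ⬝ᵥ h := by
      rw [← hq, Finset.sum_comm]
      exact Finset.sum_congr rfl fun x _ => Finset.sum_congr rfl fun y _ => by ring
    simp [midInv, Fintype.sum_sum_type, hq, hq']
    ring
  rw [hmid, det_fromBlocks₂₂, hinv, hdetmid, hschur,
    Matrix.det_unique ((Matrix.of fun (_ _ : Unit) => μ) -
      Matrix.of fun (_ _ : Unit) => 2 * ((a ᵥ* G) ⬝ᵥ h))]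
  simp

omit [Fintype V] [DecidableEq V] in
/-- The merged layout is symmetric. [cite: GrenetEtAl2011, §2.2 (after Thm 3)] -/
theorem isSymm_loopLayout (X : Matrix V V R) (a h : V → R) (μ : R) :
    (Matrix.fromBlocks (Matrix.of fun (_ _ : Unit) => μ) (Matrix.of fun _ => Sum.elim a h)
      (Matrix.of fun uv (_ : Unit) => Sum.elim a h uv) (Matrix.fromBlocks 0 Xᵀ X 0)).IsSymm := by
  refine Matrix.IsSymm.fromBlocks (by ext i j; rfl) rfl ?_
  exact Matrix.IsSymm.fromBlocks (by simp) (transpose_transpose X) (by simp)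

omit [CommRing R] [Fintype V] [DecidableEq V] in
/-- Entries of a four-block matrix satisfy a predicate if those of the blocks do. [folklore] -/
private theorem forall_fromBlocks {m n : Type*} {P : R → Prop} {A : Matrix m m R}
    {B : Matrix m n R} {C' : Matrix n m R} {D : Matrix n n R} (hA : ∀ i j, P (A i j))
    (hB : ∀ i j, P (B i j)) (hC : ∀ i j, P (C' i j)) (hD : ∀ i j, P (D i j)) :
    ∀ i j, P (Matrix.fromBlocks A B C' D i j) := by
  rintro (i | i) (j | j)
  · exact hA i j
  · exact hB i j
  · exact hC i j
  · exact hD i j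

omit [CommRing R] [Fintype V] [DecidableEq V] in
/-- Entries of a concatenated vector. [folklore] -/
private theorem forall_sumElim {W : Type*} {P : R → Prop} {a : V → R} {b : W → R}
    (ha : ∀ v, P (a v)) (hb : ∀ w, P (b w)) : ∀ x, P (Sum.elim a b x) := by
  rintro (x | x)
  · exact ha x
  · exact hb x

/-! ### The sink pair: a two-terminal program whose sink becomes a matched pair `τ` -/

section SinkPair

/-- Inverse of the sink-pair transfer matrix: old pairs `X` (inverse `G`), the edges `b` into the
new in-vertex `τ_in`, link `τ_in – τ_out` of weight `l` with inverse `l'`.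
[cite: GrenetEtAl2011, §2.2 (after Thm 3)] -/
private theorem sinkPair_mul_inv (X G : Matrix V V R) (hXG : X * G = 1) (b : V → R) (l l' : R)
    (hl : l * l' = 1) :
    Matrix.fromBlocks X (Matrix.of fun v (_ : Unit) => b v) 0 (Matrix.of fun (_ _ : Unit) => l) *
      Matrix.fromBlocks G (Matrix.of fun v (_ : Unit) => -(l' * (G *ᵥ b) v)) 0
        (Matrix.of fun (_ _ : Unit) => l') = 1 := by
  have hE : X * (Matrix.of fun v (_ : Unit) => -(l' * (G *ᵥ b) v)) +
      (Matrix.of fun v (_ : Unit) => b v) * (Matrix.of fun (_ _ : Unit) => l') = 0 := by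
    have hXGb : X *ᵥ (G *ᵥ b) = b := by rw [mulVec_mulVec, hXG, one_mulVec]
    ext v u
    have h1 : ∑ x, X v x * (G *ᵥ b) x = b v := by
      have := congrFun hXGb v
      simpa [mulVec, dotProduct] using this
    have h2 : ∑ x, X v x * (l' * (G *ᵥ b) x) = l' * b v := by
      rw [← h1, Finset.mul_sum]
      exact Finset.sum_congr rfl fun x _ => by ring
    simp [Matrix.mul_apply, h2, mul_comm]
  have hD : (Matrix.of fun (_ _ : Unit) => l) * (Matrix.of fun (_ _ : Unit) => l') =
      (1 : Matrix Unit Unit R) := by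
    ext u u'
    simp [Matrix.mul_apply, hl]
  rw [fromBlocks_multiply, hXG, hE, hD]
  simp

/-- Sink pair: `det X' = det X · l`. [folklore] -/
private theorem sinkPair_det (X : Matrix V V R) (b : V → R) (l : R) :
    (Matrix.fromBlocks X (Matrix.of fun v (_ : Unit) => b v) 0
      (Matrix.of fun (_ _ : Unit) => l)).det = X.det * l := by
  rw [det_fromBlocks_zero₂₁, Matrix.det_unique (Matrix.of fun (_ _ : Unit) => l)]
  simp

omit [DecidableEq V] in
/-- Sink pair: the path sums `a X⁻¹` at the old pairs are unchanged, and at `τ_out` the value is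
`l' · (x₀ - (a X⁻¹) · b)` (`x₀` = the direct edge `s – τ_in`). [cite: GrenetEtAl2011, §2.2 (after Thm 3)] -/
private theorem sinkPair_vecMul (G : Matrix V V R) (a b : V → R) (x₀ l' : R) :
    Sum.elim a (fun _ => x₀) ᵥ*
      Matrix.fromBlocks G (Matrix.of fun v (_ : Unit) => -(l' * (G *ᵥ b) v)) 0
        (Matrix.of fun (_ _ : Unit) => l') =
      Sum.elim (a ᵥ* G) (fun _ => l' * (x₀ - (a ᵥ* G) ⬝ᵥ b)) := by
  rw [vecMul_fromBlocks, Sum.elim_comp_inl, Sum.elim_comp_inr, vecMul_zero, add_zero]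
  congr 1
  ext u
  have h1 : (a ᵥ* Matrix.of (fun v (_ : Unit) => -(l' * (G *ᵥ b) v))) u =
      -(l' * ∑ x, a x * (G *ᵥ b) x) := by
    simp only [vecMul, dotProduct, Matrix.of_apply]
    rw [Finset.mul_sum, ← Finset.sum_neg_distrib]
    exact Finset.sum_congr rfl fun x _ => by ring
  have h2 : ((fun _ : Unit => x₀) ᵥ* Matrix.of (fun (_ _ : Unit) => l')) u = x₀ * l' := by
    simp [vecMul, dotProduct]
  have h3 : (a ᵥ* G) ⬝ᵥ b = ∑ x, a x * (G *ᵥ b) x := (dotProduct_mulVec a G b).symm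
  rw [Pi.add_apply, h1, h2, h3]
  ring

omit [DecidableEq V] in
/-- One more matched pair. [folklore] -/
private theorem card_sinkPair : Fintype.card (V ⊕ Unit) = Fintype.card V + 1 := by
  simp

end SinkPair

/-! ### Block upper-triangular transfer matrices (series composition) -/

section UpperTri

variable {V₁ V₂ : Type*} [Fintype V₁] [DecidableEq V₁] [Fintype V₂] [DecidableEq V₂]

/-- Inverse of a block upper-triangular matrix. [folklore] -/
private theorem upperTri_mul_inv (A GA : Matrix V₁ V₁ R) (hA : A * GA = 1) (D GD : Matrix V₂ V₂ R)
    (hD : D * GD = 1) (M : Matrix V₁ V₂ R) :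
    Matrix.fromBlocks A M 0 D * Matrix.fromBlocks GA (-(GA * M * GD)) 0 GD = 1 := by
  rw [fromBlocks_multiply, ← Matrix.fromBlocks_one]
  have h12 : A * -(GA * M * GD) + M * GD = 0 := by
    rw [Matrix.mul_neg, ← Matrix.mul_assoc, ← Matrix.mul_assoc, hA, Matrix.one_mul,
      neg_add_cancel]
  rw [h12, hA, Matrix.mul_zero, add_zero, Matrix.zero_mul, zero_add, Matrix.zero_mul, zero_add,
    hD, Matrix.mul_zero]

omit [DecidableEq V₁] [DecidableEq V₂] in
/-- Path sums through a block upper-triangular inverse. [folklore] -/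
private theorem upperTri_vecMul (GA : Matrix V₁ V₁ R) (GD : Matrix V₂ V₂ R) (M : Matrix V₁ V₂ R)
    (α₁ : V₁ → R) (α₂ : V₂ → R) :
    Sum.elim α₁ α₂ ᵥ* Matrix.fromBlocks GA (-(GA * M * GD)) 0 GD =
      Sum.elim (α₁ ᵥ* GA) ((α₂ - (α₁ ᵥ* GA) ᵥ* M) ᵥ* GD) := by
  rw [vecMul_fromBlocks, Sum.elim_comp_inl, Sum.elim_comp_inr, vecMul_zero, add_zero,
    Matrix.vecMul_neg, sub_vecMul, Matrix.vecMul_vecMul, Matrix.vecMul_vecMul, Matrix.mul_assoc]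
  congr 1
  abel

end UpperTri

/-! ### Series composition with a weighted series link (the special product summand) -/

section Series

variable {V₁ V₂ : Type*} [Fintype V₁] [DecidableEq V₁] [Fintype V₂] [DecidableEq V₂]

/-- The link row of the series vertex: `[[l, a₂],[0, X₂]]` times `[[l', -l'·a₂G₂],[0, G₂]]` is
the identity when `l l' = 1` and `X₂ G₂ = 1`. [folklore] -/
private theorem linkRow_mul_inv (X₂ G₂ : Matrix V₂ V₂ R) (h₂ : X₂ * G₂ = 1) (a₂ : V₂ → R)
    (l l' : R) (hl : l * l' = 1) :
    Matrix.fromBlocks (Matrix.of fun (_ _ : Unit) => l) (Matrix.of fun (_ : Unit) (v : V₂) => a₂ v)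
        0 X₂ *
      Matrix.fromBlocks (Matrix.of fun (_ _ : Unit) => l')
        (Matrix.of fun (_ : Unit) (v : V₂) => -(l' * (a₂ ᵥ* G₂) v)) 0 G₂ = 1 := by
  rw [fromBlocks_multiply, ← Matrix.fromBlocks_one, Matrix.zero_mul, zero_add, Matrix.zero_mul,
    zero_add, h₂, Matrix.mul_zero, add_zero, Matrix.mul_zero]
  have h11 : (Matrix.of fun (_ _ : Unit) => l) * (Matrix.of fun (_ _ : Unit) => l') =
      (1 : Matrix Unit Unit R) := by
    ext u u'
    simp [Matrix.mul_apply, hl]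
  have h12 : (Matrix.of fun (_ _ : Unit) => l) *
        (Matrix.of fun (_ : Unit) (v : V₂) => -(l' * (a₂ ᵥ* G₂) v)) +
      (Matrix.of fun (_ : Unit) (v : V₂) => a₂ v) * G₂ = 0 := by
    ext u v
    have hG : ((Matrix.of fun (_ : Unit) (v : V₂) => a₂ v) * G₂) u v = (a₂ ᵥ* G₂) v := by
      simp [Matrix.mul_apply, vecMul, dotProduct]
    rw [Matrix.add_apply, hG, Matrix.zero_apply]
    simp only [Matrix.mul_apply, Matrix.of_apply, Fintype.univ_ofSubsingleton,
      Finset.sum_singleton]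
    have : l * -(l' * (a₂ ᵥ* G₂) v) + (a₂ ᵥ* G₂) v = (1 - l * l') * (a₂ ᵥ* G₂) v := by ring
    rw [this, hl, sub_self, zero_mul]
  rw [h11, h12]

/-- The transfer matrix of the series composition `P₁ ; σ ; P₂` (the sink of `P₁` is the new
in-vertex `σ_in` with edges `b₁`, the source of `P₂` is `σ_out` with edges `a₂`, link
`σ_in – σ_out` of weight `l`) times its block inverse. [cite: GrenetEtAl2011, Lemma 3 (proof)] -/
private theorem seriesX_mul_seriesG (X₁ G₁ : Matrix V₁ V₁ R) (h₁ : X₁ * G₁ = 1)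
    (X₂ G₂ : Matrix V₂ V₂ R) (h₂ : X₂ * G₂ = 1) (b₁ : V₁ → R) (l l' : R) (hl : l * l' = 1)
    (a₂ : V₂ → R) :
    Matrix.fromBlocks X₁ (Matrix.of fun (v : V₁) (w : Unit ⊕ V₂) => Sum.elim (fun _ => b₁ v) 0 w) 0
      (Matrix.fromBlocks (Matrix.of fun (_ _ : Unit) => l) (Matrix.of fun (_ : Unit) (v : V₂) => a₂ v) 0 X₂) *
    Matrix.fromBlocks G₁
      (-(G₁ * (Matrix.of fun (v : V₁) (w : Unit ⊕ V₂) => Sum.elim (fun _ => b₁ v) 0 w) *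
        (Matrix.fromBlocks (Matrix.of fun (_ _ : Unit) => l')
        (Matrix.of fun (_ : Unit) (v : V₂) => -(l' * (a₂ ᵥ* G₂) v)) 0 G₂)))
      0 (Matrix.fromBlocks (Matrix.of fun (_ _ : Unit) => l')
        (Matrix.of fun (_ : Unit) (v : V₂) => -(l' * (a₂ ᵥ* G₂) v)) 0 G₂) = 1 :=
  upperTri_mul_inv X₁ G₁ h₁ _ _ (linkRow_mul_inv X₂ G₂ h₂ a₂ l l' hl) _

/-- Determinant of the series transfer matrix: `det X₁ · l · det X₂`. [folklore] -/
private theorem det_seriesX (X₁ : Matrix V₁ V₁ R) (b₁ : V₁ → R) (l : R) (a₂ : V₂ → R)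
    (X₂ : Matrix V₂ V₂ R) :
    (Matrix.fromBlocks X₁ (Matrix.of fun (v : V₁) (w : Unit ⊕ V₂) => Sum.elim (fun _ => b₁ v) 0 w) 0
      (Matrix.fromBlocks (Matrix.of fun (_ _ : Unit) => l) (Matrix.of fun (_ : Unit) (v : V₂) => a₂ v) 0 X₂)).det =
      X₁.det * l * X₂.det := by
  rw [det_fromBlocks_zero₂₁, det_fromBlocks_zero₂₁,
    Matrix.det_unique (Matrix.of fun (_ _ : Unit) => l), mul_assoc]
  rfl

omit [DecidableEq V₂] in
/-- Path sums entering the link row from `σ_in` with value `z`. [folklore] -/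
private theorem linkInv_vecMul (l' : R) (a₂ : V₂ → R) (G₂ : Matrix V₂ V₂ R) (z : R) :
    Sum.elim (fun _ : Unit => z) (0 : V₂ → R) ᵥ*
      Matrix.fromBlocks (Matrix.of fun (_ _ : Unit) => l')
        (Matrix.of fun (_ : Unit) (v : V₂) => -(l' * (a₂ ᵥ* G₂) v)) 0 G₂ =
      Sum.elim (fun _ => z * l') (fun v => -(z * l' * (a₂ ᵥ* G₂) v)) := by
  rw [vecMul_fromBlocks, Sum.elim_comp_inl, Sum.elim_comp_inr, zero_vecMul, add_zero,
    zero_vecMul, add_zero]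
  congr 1
  · ext u
    simp [vecMul, dotProduct]
  · ext v
    simp only [vecMul, dotProduct, Matrix.of_apply, Fintype.univ_ofSubsingleton,
      Finset.sum_singleton]
    ring

omit [DecidableEq V₁] [DecidableEq V₂] in
/-- **Value of the series composition**: with source edges `a₁` and the direct edge `m₁` of
`P₁` moved to `s – σ_in`, sink edges `b₂` and the direct edge `m₂` of `P₂` moved to `σ_out – s`,
the closed-walk sum is `l⁻¹ · (m₁ - a₁X₁⁻¹b₁) · (m₂ - a₂X₂⁻¹b₂)`. [cite: GrenetEtAl2011, Lemma 3 (proof)] -/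
private theorem series_value (G₁ : Matrix V₁ V₁ R) (G₂ : Matrix V₂ V₂ R) (a₁ b₁ : V₁ → R)
    (a₂ b₂ : V₂ → R) (m₁ m₂ l' : R) :
    (Sum.elim a₁ (Sum.elim (fun _ => m₁) 0) ᵥ*
      Matrix.fromBlocks G₁
      (-(G₁ * (Matrix.of fun (v : V₁) (w : Unit ⊕ V₂) => Sum.elim (fun _ => b₁ v) 0 w) *
        (Matrix.fromBlocks (Matrix.of fun (_ _ : Unit) => l')
        (Matrix.of fun (_ : Unit) (v : V₂) => -(l' * (a₂ ᵥ* G₂) v)) 0 G₂)))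
      0 (Matrix.fromBlocks (Matrix.of fun (_ _ : Unit) => l')
        (Matrix.of fun (_ : Unit) (v : V₂) => -(l' * (a₂ ᵥ* G₂) v)) 0 G₂)) ⬝ᵥ
      Sum.elim 0 (Sum.elim (fun _ => m₂) b₂) =
      l' * (m₁ - (a₁ ᵥ* G₁) ⬝ᵥ b₁) * (m₂ - (a₂ ᵥ* G₂) ⬝ᵥ b₂) := by
  rw [upperTri_vecMul, sumElim_dotProduct_sumElim, dotProduct_zero, zero_add]
  have hB : (a₁ ᵥ* G₁) ᵥ*
      (Matrix.of fun (v : V₁) (w : Unit ⊕ V₂) => Sum.elim (fun _ => b₁ v) (0 : V₂ → R) w) =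
      Sum.elim (fun _ => (a₁ ᵥ* G₁) ⬝ᵥ b₁) 0 := by
    ext w
    rcases w with u | v
    · simp [vecMul, dotProduct]
    · simp [vecMul, dotProduct]
  have hsub : Sum.elim (fun _ : Unit => m₁) (0 : V₂ → R) -
      Sum.elim (fun _ => (a₁ ᵥ* G₁) ⬝ᵥ b₁) 0 =
      Sum.elim (fun _ => m₁ - (a₁ ᵥ* G₁) ⬝ᵥ b₁) 0 := by
    ext w
    rcases w with u | v <;> simp
  rw [hB, hsub, linkInv_vecMul, sumElim_dotProduct_sumElim]
  set z := m₁ - (a₁ ᵥ* G₁) ⬝ᵥ b₁ with hz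
  have h1 : (fun _ : Unit => z * l') ⬝ᵥ (fun _ => m₂) = z * l' * m₂ := by
    simp [dotProduct]
  have h2 : (fun v => -(z * l' * (a₂ ᵥ* G₂) v)) ⬝ᵥ b₂ = -(z * l') * ((a₂ ᵥ* G₂) ⬝ᵥ b₂) := by
    simp only [dotProduct, Finset.mul_sum]
    exact Finset.sum_congr rfl fun v _ => by ring
  rw [h1, h2]
  ring

omit [DecidableEq V₁] [DecidableEq V₂] in
/-- Pairs of the series composition: `|V₁| + |V₂| + 1`. [folklore] -/
private theorem card_series : Fintype.card (V₁ ⊕ (Unit ⊕ V₂)) =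
    Fintype.card V₁ + Fintype.card V₂ + 1 := by
  simp only [Fintype.card_sum, Fintype.card_unit]
  ring

end Series

end Algebra

/-! ## Part II. Formulas: top-level summands, branches of the merged graph -/

section Formulas

variable {k : Type} [Field k] {σ : Type}

/-- Scaling the coefficients of a summand list scales its value. [folklore] -/
private theorem sum_map_scale (c : k) (L : List (k × ArithExpr k σ)) :
    ((L.map fun p => (c * p.1, p.2)).map fun p => C p.1 * p.2.eval).sum =
      C c * (L.map fun p => C p.1 * p.2.eval).sum := by
  induction L with
  | nil => simp
  | cons p L ih =>
    simp only [List.map_cons, List.sum_cons, map_mul] at ih ⊢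
    rw [ih]
    ring

omit [Field k] in
/-- A non-constant-input formula has `isConstInput = false`. [cite: GrenetEtAl2011, Def 6] -/
private theorem isConstInput_eq_false {φ : ArithExpr k σ} (h : ¬ φ.isConstInput = true) :
    φ.isConstInput = false := by
  simpa using h

/-- **Top-level summands of a formula.** Every formula is a sum `Σ c_i · T_i` of scaled summands
`T_i` each of which is a leaf (variable or constant) or a product of two formulas that are not
constant inputs, with `#summands + Σ gsize(T_i) ≤ gsize(φ) + 1` (each addition gate and each
free multiplication by a constant is absorbed), the inputs of the `T_i` among those of `φ`, and —
if `φ` has an addition gate — at least two summands or a product summand.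
[cite: GrenetEtAl2011, Def 6] -/
theorem exists_summands (φ : ArithExpr k σ) :
    ∃ L : List (k × ArithExpr k σ), L ≠ [] ∧
      φ.eval = (L.map fun p => C p.1 * p.2.eval).sum ∧
      L.length + (L.map fun p => p.2.greenSize).sum ≤ φ.greenSize + 1 ∧
      (∀ p ∈ L, ∀ q, p.2.IsInput q → φ.IsInput q) ∧
      (∀ p ∈ L, (∃ i, p.2 = ArithExpr.var i) ∨ (∃ c, p.2 = ArithExpr.const c) ∨
        ∃ ψ₁ ψ₂, p.2 = ArithExpr.mul ψ₁ ψ₂ ∧ ψ₁.isConstInput = false ∧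
          ψ₂.isConstInput = false) ∧
      (φ.HasAddition → 2 ≤ L.length ∨ ∃ p ∈ L, ∃ ψ₁ ψ₂, p.2 = ArithExpr.mul ψ₁ ψ₂) := by
  induction φ with
  | var i =>
    refine ⟨[(1, .var i)], by simp, by simp, by simp, ?_, ?_, fun h => h.elim⟩
    · intro p hp q hq
      rw [List.mem_singleton] at hp
      subst hp
      exact hq
    · intro p hp
      rw [List.mem_singleton] at hp
      subst hp
      exact Or.inl ⟨i, rfl⟩
  | const c =>
    refine ⟨[(1, .const c)], by simp, by simp, by simp, ?_, ?_, fun h => h.elim⟩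
    · intro p hp q hq
      rw [List.mem_singleton] at hp
      subst hp
      exact hq
    · intro p hp
      rw [List.mem_singleton] at hp
      subst hp
      exact Or.inr (Or.inl ⟨c, rfl⟩)
  | add φ₁ φ₂ ih₁ ih₂ =>
    obtain ⟨L₁, hne₁, hev₁, hb₁, hin₁, hk₁, -⟩ := ih₁
    obtain ⟨L₂, hne₂, hev₂, hb₂, hin₂, hk₂, -⟩ := ih₂
    refine ⟨L₁ ++ L₂, by simp [hne₁], ?_, ?_, ?_, ?_, fun _ => Or.inl ?_⟩
    · rw [ArithExpr.eval_add, hev₁, hev₂, List.map_append, List.sum_append]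
    · rw [List.length_append, List.map_append, List.sum_append, ArithExpr.greenSize_add]
      omega
    · intro p hp q hq
      rcases List.mem_append.1 hp with h | h
      · exact Or.inl (hin₁ p h q hq)
      · exact Or.inr (hin₂ p h q hq)
    · intro p hp
      rcases List.mem_append.1 hp with h | h
      · exact hk₁ p h
      · exact hk₂ p h
    · have h₁ := List.length_pos_of_ne_nil hne₁
      have h₂ := List.length_pos_of_ne_nil hne₂
      rw [List.length_append]
      omega
  | mul φ₁ φ₂ ih₁ ih₂ =>
    obtain ⟨L₁, hne₁, hev₁, hb₁, hin₁, hk₁, hadd₁⟩ := ih₁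
    obtain ⟨L₂, hne₂, hev₂, hb₂, hin₂, hk₂, hadd₂⟩ := ih₂
    by_cases h₁ : φ₁.isConstInput = true
    · obtain ⟨c, rfl⟩ := Thm3.exists_eq_const_of_isConstInput h₁
      refine ⟨L₂.map fun p => (c * p.1, p.2), by simp [hne₂], ?_, ?_, ?_, ?_, ?_⟩
      · rw [sum_map_scale, ← hev₂]; simp
      · rw [List.length_map, List.map_map, ArithExpr.greenSize_const_mul]
        exact hb₂
      · intro p hp q hq
        obtain ⟨p', hp', rfl⟩ := List.mem_map.1 hp
        exact Or.inr (hin₂ p' hp' q hq)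
      · intro p hp
        obtain ⟨p', hp', rfl⟩ := List.mem_map.1 hp
        exact hk₂ p' hp'
      · intro h
        rcases h with h | h
        · exact h.elim
        rcases hadd₂ h with h' | ⟨p, hp, ψ₁, ψ₂, hpe⟩
        · left; rwa [List.length_map]
        · right
          exact ⟨(c * p.1, p.2), List.mem_map.2 ⟨p, hp, rfl⟩, ψ₁, ψ₂, hpe⟩
    by_cases h₂ : φ₂.isConstInput = true
    · obtain ⟨c, rfl⟩ := Thm3.exists_eq_const_of_isConstInput h₂
      refine ⟨L₁.map fun p => (c * p.1, p.2), by simp [hne₁], ?_, ?_, ?_, ?_, ?_⟩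
      · rw [sum_map_scale, ← hev₁]; simp [mul_comm]
      · rw [List.length_map, List.map_map, ArithExpr.greenSize_mul_const]
        exact hb₁
      · intro p hp q hq
        obtain ⟨p', hp', rfl⟩ := List.mem_map.1 hp
        exact Or.inl (hin₁ p' hp' q hq)
      · intro p hp
        obtain ⟨p', hp', rfl⟩ := List.mem_map.1 hp
        exact hk₁ p' hp'
      · intro h
        rcases h with h | h
        swap
        · exact h.elim
        rcases hadd₁ h with h' | ⟨p, hp, ψ₁, ψ₂, hpe⟩
        · left; rwa [List.length_map]
        · right
          exact ⟨(c * p.1, p.2), List.mem_map.2 ⟨p, hp, rfl⟩, ψ₁, ψ₂, hpe⟩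
    refine ⟨[(1, .mul φ₁ φ₂)], by simp, by simp, ?_, ?_, ?_, fun _ => Or.inr ?_⟩
    · simp only [List.length_singleton, List.map_cons, List.map_nil, List.sum_cons, List.sum_nil]
      omega
    · intro p hp q hq
      rw [List.mem_singleton] at hp
      subst hp
      exact hq
    · intro p hp
      rw [List.mem_singleton] at hp
      subst hp
      exact Or.inr (Or.inr ⟨φ₁, φ₂, rfl, isConstInput_eq_false h₁, isConstInput_eq_false h₂⟩)
    · exact ⟨(1, .mul φ₁ φ₂), by simp, φ₁, φ₂, rfl⟩

/-- The engine of GKKP Lemma 3 with constants (`Thm3.exists_signedABP`) repackaged: the transfer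
matrix `X = D + N` with an explicit inverse `G`, `det X = ±1`, and the value
`c₀ · (m - (a X⁻¹) · b) = T`. [cite: GrenetEtAl2011, Thm 3 (proof)] -/
private theorem exists_engine (T : ArithExpr k σ) :
    ∃ (V : Type) (_ : Fintype V) (_ : DecidableEq V) (X G : Matrix V V (MvPolynomial σ k))
      (a b : V → MvPolynomial σ k) (m : MvPolynomial σ k) (c₀ : k),
      Fintype.card V ≤ T.greenSize ∧ X * G = 1 ∧ X.det ^ 2 = 1 ∧
      (∀ u v, T.IsInput (X u v) ∨ ∃ c : k, X u v = C c) ∧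
      (∀ v, T.IsInput (a v) ∨ ∃ c : k, a v = C c) ∧
      (∀ v, T.IsInput (b v) ∨ ∃ c : k, b v = C c) ∧
      (T.IsInput m ∨ ∃ c : k, m = C c) ∧
      C c₀ * (m - (a ᵥ* G) ⬝ᵥ b) = T.eval := by
  obtain ⟨V, _, _, d, N, a, b, m, c₀, hcard, hd, hN0, hN, ha, hb, hm, hdet, y, hy, hval⟩ :=
    Thm3.exists_signedABP T
  have hunit : IsUnit (diagonal d + N).det := by
    rcases hdet with h | h
    · rw [h]; exact isUnit_one
    · rw [h]; exact isUnit_one.neg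
  have hXG : (diagonal d + N) * (diagonal d + N)⁻¹ = 1 := Matrix.mul_nonsing_inv _ hunit
  have hGX : (diagonal d + N)⁻¹ * (diagonal d + N) = 1 := Matrix.nonsing_inv_mul _ hunit
  refine ⟨V, inferInstance, inferInstance, diagonal d + N, (diagonal d + N)⁻¹, a, b, m, c₀, hcard,
    hXG, ?_, fun u v => ?_, ha, hb, hm, ?_⟩
  · rcases hdet with h | h <;> rw [h] <;> norm_num
  · rw [Matrix.add_apply, diagonal_apply]
    by_cases huv : u = v
    · subst huv
      rw [if_pos rfl, hN0, add_zero]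
      rcases hd u with h | h
      · exact Or.inr ⟨1, by rw [h, C_1]⟩
      · exact Or.inr ⟨-1, by rw [h, C_neg, C_1]⟩
    · rw [if_neg huv, zero_add]
      exact hN u v
  · have hyG : (diagonal d + N)⁻¹ *ᵥ b = y := by
      rw [← hy, mulVec_mulVec, hGX, one_mulVec]
    rw [← dotProduct_mulVec, hyG, hval]

/-- **A summand as a branch of the merged graph (sink pair).** The two-terminal graph of a
summand `T` whose sink becomes a matched pair `τ` with link weight `l ≠ 0`: the direct edge is
moved to `s – τ_in`, and for every constant `κ` the single out-edge `τ_out – s` can be weighted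
(by the constant `κ c₀ l`) so that the closed-walk sum through the branch is exactly `κ · T`.
Pairs: `≤ gsize(T) + 1`. [cite: GrenetEtAl2011, §2.2 (after Thm 3)] -/
theorem exists_sinkBranch (T : ArithExpr k σ) :
    ∃ (V : Type) (_ : Fintype V) (_ : DecidableEq V), Fintype.card V ≤ T.greenSize + 1 ∧
      ∀ l : k, l ≠ 0 → ∃ (X G : Matrix V V (MvPolynomial σ k)) (α : V → MvPolynomial σ k),
        X * G = 1 ∧ X.det ^ 2 = C (l ^ 2) ∧
        (∀ u v, T.IsInput (X u v) ∨ ∃ c : k, X u v = C c) ∧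
        (∀ v, T.IsInput (α v) ∨ ∃ c : k, α v = C c) ∧
        ∀ κ : k, ∃ β : V → MvPolynomial σ k, (∀ v, ∃ c : k, β v = C c) ∧
          (α ᵥ* G) ⬝ᵥ β = C κ * T.eval := by
  obtain ⟨V, _, _, X, G, a, b, m, c₀, hcard, hXG, hdet, hX, ha, hb, hm, hval⟩ := exists_engine T
  refine ⟨V ⊕ Unit, inferInstance, inferInstance, by rw [card_sinkPair]; omega, ?_⟩
  intro l hl
  have hll : (C l : MvPolynomial σ k) * C l⁻¹ = 1 := by
    rw [← C_mul, mul_inv_cancel₀ hl, C_1]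
  refine ⟨Matrix.fromBlocks X (Matrix.of fun v (_ : Unit) => b v) 0 (Matrix.of fun (_ _ : Unit) => C l),
    Matrix.fromBlocks G (Matrix.of fun v (_ : Unit) => -(C l⁻¹ * (G *ᵥ b) v)) 0
      (Matrix.of fun (_ _ : Unit) => C l⁻¹),
    Sum.elim a (fun _ => m), sinkPair_mul_inv X G hXG b _ _ hll, ?_, ?_, ?_, ?_⟩
  · rw [sinkPair_det, mul_pow, hdet, one_mul, ← C_pow]
  · refine forall_fromBlocks (P := fun p => T.IsInput p ∨ ∃ c : k, p = C c) hX
      (fun v _ => hb v) (fun _ _ => Or.inr ⟨0, (map_zero C).symm⟩) (fun _ _ => Or.inr ⟨l, rfl⟩)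
  · exact forall_sumElim (P := fun p => T.IsInput p ∨ ∃ c : k, p = C c) ha (fun _ => hm)
  · intro κ
    refine ⟨Sum.elim 0 (fun _ => C (κ * c₀ * l)), ?_, ?_⟩
    · rintro (v | u)
      · exact ⟨0, by simp⟩
      · exact ⟨κ * c₀ * l, rfl⟩
    · rw [sinkPair_vecMul, sumElim_dotProduct_sumElim, dotProduct_zero, zero_add, ← hval]
      rw [show (fun _ : Unit => C l⁻¹ * (m - (a ᵥ* G) ⬝ᵥ b)) ⬝ᵥ (fun _ : Unit => C (κ * c₀ * l)) =
          C l⁻¹ * (m - (a ᵥ* G) ⬝ᵥ b) * C (κ * c₀ * l) from by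
        rw [dotProduct, Fintype.sum_unique]]
      simp only [map_mul]
      have : (C l⁻¹ : MvPolynomial σ k) * C l = 1 := by rw [mul_comm, hll]
      linear_combination (C κ * C c₀ * (m - (a ᵥ* G) ⬝ᵥ b)) * this

/-- **The special product summand as a series branch.** For `T = ψ₁ × ψ₂`: the series
composition of the two-terminal graphs of `ψ₁`, `ψ₂` (sink of the first = series vertex `σ_in`,
source of the second = `σ_out`, link of weight `l`), direct edges moved to `s – σ_in` and
`σ_out – s`, sink edges of `ψ₂` into `s`: closed-walk sum `w` with `c₁ c₂ l · w = ψ₁ ψ₂`;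
`det² = l²`; pairs `≤ gsize ψ₁ + gsize ψ₂ + 1`. [cite: GrenetEtAl2011, Lemma 3 (proof)] -/
theorem exists_seriesBranch (ψ₁ ψ₂ : ArithExpr k σ) :
    ∃ (V : Type) (_ : Fintype V) (_ : DecidableEq V) (c₁ c₂ : k),
      Fintype.card V ≤ ψ₁.greenSize + ψ₂.greenSize + 1 ∧
      ∀ l : k, l ≠ 0 → ∃ (X G : Matrix V V (MvPolynomial σ k)) (α β : V → MvPolynomial σ k),
        X * G = 1 ∧ X.det ^ 2 = C (l ^ 2) ∧
        (∀ u v, (ArithExpr.mul ψ₁ ψ₂).IsInput (X u v) ∨ ∃ c : k, X u v = C c) ∧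
        (∀ v, (ArithExpr.mul ψ₁ ψ₂).IsInput (α v) ∨ ∃ c : k, α v = C c) ∧
        (∀ v, (ArithExpr.mul ψ₁ ψ₂).IsInput (β v) ∨ ∃ c : k, β v = C c) ∧
        C (c₁ * c₂ * l) * ((α ᵥ* G) ⬝ᵥ β) = ψ₁.eval * ψ₂.eval := by
  obtain ⟨V₁, _, _, X₁, G₁, a₁, b₁, m₁, c₁, hcard₁, hXG₁, hdet₁, hX₁, ha₁, hb₁, hm₁, hval₁⟩ :=
    exists_engine ψ₁
  obtain ⟨V₂, _, _, X₂, G₂, a₂, b₂, m₂, c₂, hcard₂, hXG₂, hdet₂, hX₂, ha₂, hb₂, hm₂, hval₂⟩ :=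
    exists_engine ψ₂
  refine ⟨V₁ ⊕ (Unit ⊕ V₂), inferInstance, inferInstance, c₁, c₂, by rw [card_series]; omega, ?_⟩
  intro l hl
  have hll : (C l : MvPolynomial σ k) * C l⁻¹ = 1 := by
    rw [← C_mul, mul_inv_cancel₀ hl, C_1]
  have ok0 : (ArithExpr.mul ψ₁ ψ₂).IsInput (0 : MvPolynomial σ k) ∨
      ∃ c : k, (0 : MvPolynomial σ k) = C c := Or.inr ⟨0, (map_zero C).symm⟩
  have in₁ : ∀ {p}, (ψ₁.IsInput p ∨ ∃ c : k, p = C c) →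
      ((ArithExpr.mul ψ₁ ψ₂).IsInput p ∨ ∃ c : k, p = C c) := fun h =>
    h.elim (fun h => Or.inl (Or.inl h)) Or.inr
  have in₂ : ∀ {p}, (ψ₂.IsInput p ∨ ∃ c : k, p = C c) →
      ((ArithExpr.mul ψ₁ ψ₂).IsInput p ∨ ∃ c : k, p = C c) := fun h =>
    h.elim (fun h => Or.inl (Or.inr h)) Or.inr
  refine ⟨Matrix.fromBlocks X₁ (Matrix.of fun (v : V₁) (w : Unit ⊕ V₂) => Sum.elim (fun _ => b₁ v) 0 w) 0
      (Matrix.fromBlocks (Matrix.of fun (_ _ : Unit) => C l) (Matrix.of fun (_ : Unit) (v : V₂) => a₂ v) 0 X₂),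
    Matrix.fromBlocks G₁
      (-(G₁ * (Matrix.of fun (v : V₁) (w : Unit ⊕ V₂) => Sum.elim (fun _ => b₁ v) 0 w) *
        (Matrix.fromBlocks (Matrix.of fun (_ _ : Unit) => C l⁻¹)
        (Matrix.of fun (_ : Unit) (v : V₂) => -(C l⁻¹ * (a₂ ᵥ* G₂) v)) 0 G₂)))
      0 (Matrix.fromBlocks (Matrix.of fun (_ _ : Unit) => C l⁻¹)
        (Matrix.of fun (_ : Unit) (v : V₂) => -(C l⁻¹ * (a₂ ᵥ* G₂) v)) 0 G₂),
    Sum.elim a₁ (Sum.elim (fun _ => m₁) 0), Sum.elim 0 (Sum.elim (fun _ => m₂) b₂),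
    seriesX_mul_seriesG X₁ G₁ hXG₁ X₂ G₂ hXG₂ b₁ _ _ hll a₂, ?_, ?_, ?_, ?_, ?_⟩
  · rw [det_seriesX, mul_pow, mul_pow, hdet₁, hdet₂, one_mul, mul_one, ← C_pow]
  · refine forall_fromBlocks (P := fun p => (ArithExpr.mul ψ₁ ψ₂).IsInput p ∨ ∃ c : k, p = C c)
      (fun u v => in₁ (hX₁ u v)) (fun v w => ?_) (fun _ _ => ok0) ?_
    · rcases w with u | w
      · exact in₁ (hb₁ v)
      · exact ok0
    · exact forall_fromBlocks (P := fun p => (ArithExpr.mul ψ₁ ψ₂).IsInput p ∨ ∃ c : k, p = C c)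
        (fun _ _ => Or.inr ⟨l, rfl⟩) (fun _ v => in₂ (ha₂ v)) (fun _ _ => ok0)
        (fun u v => in₂ (hX₂ u v))
  · exact forall_sumElim (P := fun p => (ArithExpr.mul ψ₁ ψ₂).IsInput p ∨ ∃ c : k, p = C c)
      (fun v => in₁ (ha₁ v))
      (forall_sumElim (P := fun p => (ArithExpr.mul ψ₁ ψ₂).IsInput p ∨ ∃ c : k, p = C c)
        (fun _ => in₁ hm₁) (fun _ => ok0))
  · exact forall_sumElim (P := fun p => (ArithExpr.mul ψ₁ ψ₂).IsInput p ∨ ∃ c : k, p = C c)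
      (fun _ => ok0)
      (forall_sumElim (P := fun p => (ArithExpr.mul ψ₁ ψ₂).IsInput p ∨ ∃ c : k, p = C c)
        (fun _ => in₂ hm₂) (fun v => in₂ (hb₂ v)))
  · rw [series_value, ← hval₁, ← hval₂]
    simp only [map_mul]
    have : (C l⁻¹ : MvPolynomial σ k) * C l = 1 := by rw [mul_comm, hll]
    linear_combination (C c₁ * (m₁ - (a₁ ᵥ* G₁) ⬝ᵥ b₁) * (C c₂ * (m₂ - (a₂ ᵥ* G₂) ⬝ᵥ b₂))) * this

/-- **The ordinary summands assembled at the common vertex `s`** (disjoint branches, links `1`):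
pairs `≤ #summands + Σ gsize`, `det² = 1`, and for every constant `κ` out-edge weights giving
the closed-walk sum `κ · Σ c_i T_i`. [cite: GrenetEtAl2011, §2.2 (after Thm 3)] -/
theorem exists_assembly (L : List (k × ArithExpr k σ)) :
    ∃ (V : Type) (_ : Fintype V) (_ : DecidableEq V) (X G : Matrix V V (MvPolynomial σ k))
      (α : V → MvPolynomial σ k),
      Fintype.card V ≤ L.length + (L.map fun p => p.2.greenSize).sum ∧
      X * G = 1 ∧ X.det ^ 2 = 1 ∧
      (∀ u v, (∃ p ∈ L, p.2.IsInput (X u v)) ∨ ∃ c : k, X u v = C c) ∧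
      (∀ v, (∃ p ∈ L, p.2.IsInput (α v)) ∨ ∃ c : k, α v = C c) ∧
      ∀ κ : k, ∃ β : V → MvPolynomial σ k, (∀ v, ∃ c : k, β v = C c) ∧
        (α ᵥ* G) ⬝ᵥ β = C κ * (L.map fun p => C p.1 * p.2.eval).sum := by
  induction L with
  | nil =>
    refine ⟨PEmpty, inferInstance, inferInstance, 1, 1, PEmpty.elim, by simp, Matrix.one_mul _,
      by simp, fun u => u.elim, fun u => u.elim, fun κ => ⟨PEmpty.elim, fun v => v.elim, ?_⟩⟩
    simp [dotProduct]
  | cons p L ih =>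
    obtain ⟨V₁, _, _, hcard₁, hbr⟩ := exists_sinkBranch p.2
    obtain ⟨X₁, G₁, α₁, hXG₁, hdet₁, hX₁, hα₁, hβ₁⟩ := hbr 1 one_ne_zero
    obtain ⟨V₂, _, _, X₂, G₂, α₂, hcard₂, hXG₂, hdet₂, hX₂, hα₂, hβ₂⟩ := ih
    refine ⟨V₁ ⊕ V₂, inferInstance, inferInstance, Matrix.fromBlocks X₁ 0 0 X₂,
      Matrix.fromBlocks G₁ 0 0 G₂, Sum.elim α₁ α₂, ?_, ?_, ?_, ?_, ?_, ?_⟩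
    · simp only [Fintype.card_sum, List.length_cons, List.map_cons, List.sum_cons]
      omega
    · rw [fromBlocks_multiply]
      simp [hXG₁, hXG₂]
    · rw [det_fromBlocks_zero₂₁, mul_pow, hdet₁, hdet₂, one_pow, C_1, one_mul]
    · refine forall_fromBlocks (P := fun q => (∃ p' ∈ p :: L, p'.2.IsInput q) ∨ ∃ c : k, q = C c)
        (fun u v => ?_) (fun _ _ => Or.inr ⟨0, (map_zero C).symm⟩)
        (fun _ _ => Or.inr ⟨0, (map_zero C).symm⟩) (fun u v => ?_)
      · rcases hX₁ u v with h | h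
        · exact Or.inl ⟨p, List.mem_cons_self, h⟩
        · exact Or.inr h
      · rcases hX₂ u v with ⟨p', hp', h⟩ | h
        · exact Or.inl ⟨p', List.mem_cons_of_mem p hp', h⟩
        · exact Or.inr h
    · refine forall_sumElim (P := fun q => (∃ p' ∈ p :: L, p'.2.IsInput q) ∨ ∃ c : k, q = C c)
        (fun v => ?_) (fun v => ?_)
      · rcases hα₁ v with h | h
        · exact Or.inl ⟨p, List.mem_cons_self, h⟩
        · exact Or.inr h
      · rcases hα₂ v with ⟨p', hp', h⟩ | h
        · exact Or.inl ⟨p', List.mem_cons_of_mem p hp', h⟩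
        · exact Or.inr h
    · intro κ
      obtain ⟨β₁, hβ₁c, hv₁⟩ := hβ₁ (κ * p.1)
      obtain ⟨β₂, hβ₂c, hv₂⟩ := hβ₂ κ
      refine ⟨Sum.elim β₁ β₂, ?_, ?_⟩
      · rintro (v | v)
        · exact hβ₁c v
        · exact hβ₂c v
      · rw [vecMul_fromBlocks, Sum.elim_comp_inl, Sum.elim_comp_inr, vecMul_zero, vecMul_zero,
          add_zero, zero_add, sumElim_dotProduct_sumElim, hv₁, hv₂, List.map_cons, List.sum_cons,
          map_mul]
        ring

end Formulas

/-! ## Part III. The merged layout of a formula and the three cases -/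

section Final

variable {k : Type} [Field k] {σ : Type}

/-- `(-1)^P` as a constant. [folklore] -/
private theorem neg_one_pow_eq_C (P : ℕ) : ((-1 : MvPolynomial σ k) ^ P) = C ((-1 : k) ^ P) := by
  rw [map_pow, map_neg, C_1]

/-- **The final matrix.** From merged-graph data (pairs `V`, transfer matrix `X` with inverse `G`
and `det X² = D`, edges `α` at the in-copies and `β` at the out-copies, loop `μ` at `s`; entries
inputs of `φ` or constants) the loop layout gives a symmetric matrix of dimension `2|V|+1` with
determinant `(-1)^{|V|} D (μ - 2 (αX⁻¹)·β)`; with `ε = -1` one more vertex carrying a loop of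
weight `-1` negates it ("adding a new line and a new column, filled with zeroes but the diagonal
element with `-1`"). [cite: GrenetEtAl2011, §2.2 (after Thm 3)] -/
theorem exists_layout (φ : ArithExpr k σ) {V : Type} [Fintype V] [DecidableEq V]
    (X G : Matrix V V (MvPolynomial σ k)) (hXG : X * G = 1) (D : k) (hdet : X.det ^ 2 = C D)
    (α β : V → MvPolynomial σ k) (μ : MvPolynomial σ k)
    (hX : ∀ u v, φ.IsInput (X u v) ∨ ∃ c : k, X u v = C c)
    (hα : ∀ v, φ.IsInput (α v) ∨ ∃ c : k, α v = C c)
    (hβ : ∀ v, φ.IsInput (β v) ∨ ∃ c : k, β v = C c)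
    (hμ : φ.IsInput μ ∨ ∃ c : k, μ = C c) (ε : k) (hε : ε = 1 ∨ ε = -1) :
    ∃ N, (N = 2 * Fintype.card V + 1 ∧ ε = 1 ∨ N = 2 * Fintype.card V + 2 ∧ ε = -1) ∧
      ∃ A : Matrix (Fin N) (Fin N) (MvPolynomial σ k), A.IsSymm ∧
        (∀ a b, φ.IsInput (A a b) ∨ ∃ c : k, A a b = C c) ∧
        A.det = C ε * ((-1) ^ Fintype.card V * C D * (μ - 2 * ((α ᵥ* G) ⬝ᵥ β))) := by
  set S := Matrix.fromBlocks (Matrix.of fun (_ _ : Unit) => μ) (Matrix.of fun _ => Sum.elim α β)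
    (Matrix.of fun uv (_ : Unit) => Sum.elim α β uv) (Matrix.fromBlocks 0 Xᵀ X 0) with hS
  have hdetS : S.det = (-1) ^ Fintype.card V * C D * (μ - 2 * ((α ᵥ* G) ⬝ᵥ β)) := by
    rw [hS, det_loopLayout X G hXG α β μ, hdet]
  have hsymmS : S.IsSymm := isSymm_loopLayout X α β μ
  let P : MvPolynomial σ k → Prop := fun p => φ.IsInput p ∨ ∃ c : k, p = C c
  have ok0 : P 0 := Or.inr ⟨0, (map_zero C).symm⟩
  have hbord : ∀ uv, P (Sum.elim α β uv) := forall_sumElim (P := P) hα hβ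
  have hentS : ∀ x y, P (S x y) := by
    refine forall_fromBlocks (P := P) (fun _ _ => hμ) (fun _ uv => hbord uv)
      (fun uv _ => hbord uv) ?_
    exact forall_fromBlocks (P := P) (fun _ _ => ok0) (fun x y => hX y x) hX (fun _ _ => ok0)
  rcases hε with hε | hε
  · subst hε
    let eqv : Unit ⊕ (V ⊕ V) ≃ Fin (2 * Fintype.card V + 1) :=
      Fintype.equivFinOfCardEq Thm4.card_layout
    refine ⟨2 * Fintype.card V + 1, Or.inl ⟨rfl, rfl⟩, S.submatrix eqv.symm eqv.symm,
      hsymmS.submatrix _, fun x y => ?_, ?_⟩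
    · rw [Matrix.submatrix_apply]; exact hentS _ _
    · rw [Matrix.det_submatrix_equiv_self, hdetS, C_1, one_mul]
  · subst hε
    set S' := Matrix.fromBlocks S 0 0 (Matrix.of fun (_ _ : Unit) => (-1 : MvPolynomial σ k))
      with hS'
    have hcard' : Fintype.card ((Unit ⊕ (V ⊕ V)) ⊕ Unit) = 2 * Fintype.card V + 2 := by
      simp only [Fintype.card_sum, Fintype.card_unit]; ring
    let eqv : (Unit ⊕ (V ⊕ V)) ⊕ Unit ≃ Fin (2 * Fintype.card V + 2) :=
      Fintype.equivFinOfCardEq hcard'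
    refine ⟨2 * Fintype.card V + 2, Or.inr ⟨rfl, rfl⟩, S'.submatrix eqv.symm eqv.symm,
      Matrix.IsSymm.submatrix ?_ _, fun x y => ?_, ?_⟩
    · exact Matrix.IsSymm.fromBlocks hsymmS (by simp) (by ext i j; rfl)
    · rw [Matrix.submatrix_apply, hS']
      exact forall_fromBlocks (P := P) hentS (fun _ _ => ok0) (fun _ _ => ok0)
        (fun _ _ => Or.inr ⟨-1, by simp⟩) _ _
    · rw [Matrix.det_submatrix_equiv_self, hS', det_fromBlocks_zero₂₁, hdetS,
        Matrix.det_unique (Matrix.of fun (_ _ : Unit) => (-1 : MvPolynomial σ k)), map_neg, C_1]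
      simp only [Matrix.of_apply]
      ring

/-- Splitting the value of a summand list at a member. [folklore] -/
private theorem sum_split (L₁ L₂ : List (k × ArithExpr k σ)) (p : k × ArithExpr k σ) :
    ((L₁ ++ p :: L₂).map fun q => C q.1 * q.2.eval).sum =
      C p.1 * p.2.eval + ((L₁ ++ L₂).map fun q => C q.1 * q.2.eval).sum := by
  simp only [List.map_append, List.map_cons, List.sum_append, List.sum_cons]
  ring

omit [Field k] in
/-- Splitting the green sizes of a summand list at a member. [folklore] -/
private theorem gsum_split (L₁ L₂ : List (k × ArithExpr k σ)) (p : k × ArithExpr k σ) :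
    ((L₁ ++ p :: L₂).map fun q => q.2.greenSize).sum =
      p.2.greenSize + ((L₁ ++ L₂).map fun q => q.2.greenSize).sum := by
  simp only [List.map_append, List.map_cons, List.sum_append, List.sum_cons]
  ring

omit [Field k] in
/-- Splitting the length of a summand list at a member. [folklore] -/
private theorem length_split (L₁ L₂ : List (k × ArithExpr k σ)) (p : k × ArithExpr k σ) :
    (L₁ ++ p :: L₂).length = (L₁ ++ L₂).length + 1 := by
  simp only [List.length_append, List.length_cons]
  ring

omit [Field k] in
/-- Members of the two sides are members of the whole list. [folklore] -/
private theorem mem_split {L₁ L₂ : List (k × ArithExpr k σ)} {p q : k × ArithExpr k σ}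
    (h : q ∈ L₁ ++ L₂) : q ∈ L₁ ++ p :: L₂ := by
  rcases List.mem_append.1 h with h | h
  · exact List.mem_append_left _ h
  · exact List.mem_append_right _ (List.mem_cons_of_mem p h)

/-- **The sharpened construction (all cases).** For a formula with an addition gate over a field
of characteristic `≠ 2` in which every nonzero `c` has `l ≠ 0`, `ε ∈ {1, -1}` with `l² = ε c`
(and `ε = -1` only if the extra vertex is allowed, `extraOK`): a symmetric matrix of dimension
`≤ 2·gsize(φ) + 1` (or `≤ 2·gsize(φ) + 2` using the extra vertex) with entries inputs of `φ` or
constants and determinant `φ`. Cases: a nonzero product summand (series branch with the link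
weight solving a LINEAR equation), a constant summand (it becomes the loop at `s`), all summands
nonzero multiples of variables (one variable is the loop at `s`, a square root fixes its
coefficient). [cite: GrenetEtAl2011, §2.2 (after Thm 3)] -/
theorem sharp_core (extraOK : Prop) (h2 : (2 : k) ≠ 0)
    (hroot : ∀ c : k, c ≠ 0 → ∃ l ε : k, l ≠ 0 ∧ (ε = 1 ∨ (ε = -1 ∧ extraOK)) ∧ l * l = ε * c)
    (φ : ArithExpr k σ) (hadd : φ.HasAddition) :
    ∃ N, (N ≤ 2 * φ.greenSize + 1 ∨ (extraOK ∧ N ≤ 2 * φ.greenSize + 2)) ∧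
      ∃ A : Matrix (Fin N) (Fin N) (MvPolynomial σ k), A.IsSymm ∧
        (∀ a b, φ.IsInput (A a b) ∨ ∃ c : k, A a b = C c) ∧ A.det = φ.eval := by
  classical
  obtain ⟨L, hne, hev, hbud, hin, hkind, hadd'⟩ := exists_summands φ
  have okC : ∀ e : k, φ.IsInput (C e : MvPolynomial σ k) ∨ ∃ c : k, (C e : MvPolynomial σ k) =
      C c := fun e => Or.inr ⟨e, rfl⟩
  -- Case A: a nonzero product summand
  by_cases hA : ∃ p ∈ L, (∃ ψ₁ ψ₂, p.2 = ArithExpr.mul ψ₁ ψ₂ ∧ ψ₁.isConstInput = false ∧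
      ψ₂.isConstInput = false) ∧ C p.1 * p.2.eval ≠ 0
  · obtain ⟨p, hp, ⟨ψ₁, ψ₂, hpe, hc1, hc2⟩, hpz⟩ := hA
    obtain ⟨L₁, L₂, hL⟩ := List.append_of_mem hp
    obtain ⟨Vs, _, _, c₁, c₂, hcards, hbrs⟩ := exists_seriesBranch (k := k) ψ₁ ψ₂
    obtain ⟨Vo, _, _, Xo, Go, αo, hcardo, hXGo, hdeto, hXo, hαo, hβo⟩ :=
      exists_assembly (L₁ ++ L₂)
    set P := Fintype.card Vs + Fintype.card Vo with hP
    set s' : k := (-1) ^ P with hs'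
    have hs'2 : s' ^ 2 = 1 := by rw [hs', ← pow_mul, mul_comm, pow_mul, neg_one_sq, one_pow]
    have hs'0 : s' ≠ 0 := by
      intro h; rw [h] at hs'2; norm_num at hs'2
    set c := p.1 with hc
    have hc0 : c ≠ 0 := by
      intro h; apply hpz; rw [h, C_0, zero_mul]
    have hc12 : c₁ * c₂ ≠ 0 := by
      intro h
      obtain ⟨X1, G1, α1, β1, -, -, -, -, -, hw⟩ := hbrs 1 one_ne_zero
      apply hpz
      rw [hpe, ArithExpr.eval_mul, ← hw, mul_one, h, C_0, zero_mul, mul_zero]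
    set l : k := -(s' * c * (c₁ * c₂)) / 2 with hl
    have hl0 : l ≠ 0 := by
      rw [hl]
      exact div_ne_zero (neg_ne_zero.2 (mul_ne_zero (mul_ne_zero hs'0 hc0) hc12)) h2
    obtain ⟨Xs, Gs, αs, βs, hXGs, hdets, hXs, hαs, hβs, hw⟩ := hbrs l hl0
    set κ : k := -s' / (2 * l ^ 2) with hκ
    obtain ⟨βo, hβoc, hwo⟩ := hβo κ
    -- scalar identities
    have hi : s' * l ^ 2 * (-2) = c * (c₁ * c₂ * l) := by
      have : l * 2 = -(s' * c * (c₁ * c₂)) := by rw [hl]; field_simp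
      linear_combination (-(s' * l)) * this + (c * (c₁ * c₂) * l) * hs'2
    have hii : s' * l ^ 2 * (-2) * κ = 1 := by
      rw [hκ]
      field_simp
      linear_combination hs'2
    -- the merged data
    have inP : ∀ {q}, ((ArithExpr.mul ψ₁ ψ₂).IsInput q ∨ ∃ e : k, q = C e) →
        (φ.IsInput q ∨ ∃ e : k, q = C e) := fun h =>
      h.elim (fun h => Or.inl (hin p hp _ (hpe ▸ h))) Or.inr
    have inO : ∀ {q}, ((∃ p' ∈ L₁ ++ L₂, p'.2.IsInput q) ∨ ∃ e : k, q = C e) →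
        (φ.IsInput q ∨ ∃ e : k, q = C e) := fun h =>
      h.elim (fun ⟨p', hp', h⟩ => Or.inl (hin p' (hL ▸ mem_split hp') _ h)) Or.inr
    have ok0 : φ.IsInput (0 : MvPolynomial σ k) ∨ ∃ e : k, (0 : MvPolynomial σ k) = C e :=
      Or.inr ⟨0, (map_zero C).symm⟩
    obtain ⟨N, hN, A, hAsymm, hAent, hAdet⟩ := exists_layout φ
      (Matrix.fromBlocks Xs 0 0 Xo) (Matrix.fromBlocks Gs 0 0 Go)
      (by rw [fromBlocks_multiply]; simp [hXGs, hXGo]) (l ^ 2)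
      (by rw [det_fromBlocks_zero₂₁, mul_pow, hdets, hdeto, mul_one])
      (Sum.elim αs αo) (Sum.elim βs βo) 0
      (forall_fromBlocks (P := fun q => φ.IsInput q ∨ ∃ e : k, q = C e)
        (fun u v => inP (hXs u v)) (fun _ _ => ok0) (fun _ _ => ok0) (fun u v => inO (hXo u v)))
      (forall_sumElim (P := fun q => φ.IsInput q ∨ ∃ e : k, q = C e) (fun v => inP (hαs v))
        (fun v => inO (hαo v)))
      (forall_sumElim (P := fun q => φ.IsInput q ∨ ∃ e : k, q = C e) (fun v => inP (hβs v))
        (fun v => Or.inr (hβoc v)))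
      ok0 1 (Or.inl rfl)
    rcases hN with ⟨hN, -⟩ | ⟨-, h1⟩
    swap
    · exact absurd (by linear_combination h1 : (2 : k) = 0) h2
    refine ⟨N, Or.inl ?_, A, hAsymm, hAent, ?_⟩
    · -- budget
      have hgs : p.2.greenSize = ψ₁.greenSize + ψ₂.greenSize + 1 := by
        rw [hpe, ArithExpr.greenSize_mul _ _ hc1 hc2]
      rw [hL, length_split, gsum_split] at hbud
      simp only [Fintype.card_sum] at hN
      omega
    · rw [hAdet, hev, hL, sum_split, vecMul_fromBlocks, Sum.elim_comp_inl, Sum.elim_comp_inr,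
        vecMul_zero, vecMul_zero, add_zero, zero_add, sumElim_dotProduct_sumElim, hwo,
        Fintype.card_sum, ← hP, neg_one_pow_eq_C, ← hs', hpe, ArithExpr.eval_mul, ← hw, C_1,
        one_mul]
      have hi' : (C s' * C (l ^ 2) * (-2) : MvPolynomial σ k) = C c * C (c₁ * c₂ * l) := by
        rw [← C_mul, ← C_mul, show (-2 : MvPolynomial σ k) = C (-2) by rw [map_neg, map_ofNat],
          ← C_mul, hi]
      have hii' : (C s' * C (l ^ 2) * (-2) * C κ : MvPolynomial σ k) = 1 := by
        rw [show (-2 : MvPolynomial σ k) = C (-2) by rw [map_neg, map_ofNat], ← C_mul, ← C_mul,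
          ← C_mul, hii, C_1]
      linear_combination ((αs ᵥ* Gs) ⬝ᵥ βs) * hi' +
        (((L₁ ++ L₂).map fun q => C q.1 * q.2.eval).sum) * hii'
  -- Case B: a constant summand
  by_cases hB : ∃ p ∈ L, ∃ e : k, C p.1 * p.2.eval = C e
  · obtain ⟨p, hp, e, hpe⟩ := hB
    obtain ⟨L₁, L₂, hL⟩ := List.append_of_mem hp
    obtain ⟨Vo, _, _, Xo, Go, αo, hcardo, hXGo, hdeto, hXo, hαo, hβo⟩ :=
      exists_assembly (L₁ ++ L₂)
    set P := Fintype.card Vo with hP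
    set s' : k := (-1) ^ P with hs'
    have hs'2 : s' ^ 2 = 1 := by rw [hs', ← pow_mul, mul_comm, pow_mul, neg_one_sq, one_pow]
    set κ : k := -s' / 2 with hκ
    obtain ⟨βo, hβoc, hwo⟩ := hβo κ
    have inO : ∀ {q}, ((∃ p' ∈ L₁ ++ L₂, p'.2.IsInput q) ∨ ∃ e : k, q = C e) →
        (φ.IsInput q ∨ ∃ e : k, q = C e) := fun h =>
      h.elim (fun ⟨p', hp', h⟩ => Or.inl (hin p' (hL ▸ mem_split hp') _ h)) Or.inr
    obtain ⟨N, hN, A, hAsymm, hAent, hAdet⟩ := exists_layout φ Xo Go hXGo 1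
      (by rw [hdeto, C_1]) αo βo (C (s' * e)) (fun u v => inO (hXo u v)) (fun v => inO (hαo v))
      (fun v => Or.inr (hβoc v)) (okC _) 1 (Or.inl rfl)
    rcases hN with ⟨hN, -⟩ | ⟨-, h1⟩
    swap
    · exact absurd (by linear_combination h1 : (2 : k) = 0) h2
    refine ⟨N, Or.inl ?_, A, hAsymm, hAent, ?_⟩
    · rw [hL, length_split, gsum_split] at hbud
      omega
    · rw [hAdet, hev, hL, sum_split, hpe, hwo, ← hP, neg_one_pow_eq_C, ← hs', C_1, one_mul,
        mul_one]
      have h1 : (C s' * C (s' * e) : MvPolynomial σ k) = C e := by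
        rw [← C_mul, ← mul_assoc, ← pow_two, hs'2, one_mul]
      have h2' : (C s' * (2 * C κ) : MvPolynomial σ k) = -1 := by
        rw [show (2 : MvPolynomial σ k) = C 2 by rw [map_ofNat], ← C_mul, ← C_mul, hκ,
          show s' * (2 * (-s' / 2)) = -(s' ^ 2) by field_simp, hs'2, C_neg, C_1]
      linear_combination h1 - (((L₁ ++ L₂).map fun q => C q.1 * q.2.eval).sum) * h2'
  -- Case C: all summands are nonzero multiples of variables
  have hvar : ∀ p ∈ L, (∃ i, p.2 = ArithExpr.var i) ∧ p.1 ≠ 0 := by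
    intro p hp
    have hp0 : C p.1 * p.2.eval ≠ 0 := fun h => hB ⟨p, hp, 0, by rw [h, C_0]⟩
    refine ⟨?_, fun h => hp0 (by rw [h, C_0, zero_mul])⟩
    rcases hkind p hp with h | ⟨c, h⟩ | ⟨ψ₁, ψ₂, h, h₁, h₂⟩
    · exact h
    · exact absurd ⟨p, hp, p.1 * c, by rw [h, ArithExpr.eval_const, C_mul]⟩ hB
    · exact absurd ⟨p, hp, ⟨ψ₁, ψ₂, h, h₁, h₂⟩, hp0⟩ hA
  have hlen : 2 ≤ L.length := by
    rcases hadd' hadd with h | ⟨p, hp, ψ₁, ψ₂, h⟩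
    · exact h
    · obtain ⟨⟨i, hi⟩, -⟩ := hvar p hp
      rw [hi] at h
      cases h
  obtain ⟨p, M, rfl⟩ : ∃ p M, L = p :: M := by
    cases L with
    | nil => exact absurd rfl hne
    | cons p M => exact ⟨p, M, rfl⟩
  obtain ⟨p', L'', rfl⟩ : ∃ p' L'', M = p' :: L'' := by
    cases M with
    | nil => simp at hlen
    | cons p' L'' => exact ⟨p', L'', rfl⟩
  obtain ⟨⟨i, hpi⟩, hc0⟩ := hvar p List.mem_cons_self
  obtain ⟨⟨i', hpi'⟩, -⟩ := hvar p' (List.mem_cons_of_mem p List.mem_cons_self)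
  set c := p.1 with hc
  set c' := p'.1 with hc'
  obtain ⟨V₁, _, _, hcard₁, hbr⟩ := exists_sinkBranch (k := k) p'.2
  obtain ⟨V₂, _, _, X₂, G₂, α₂, hcard₂, hXG₂, hdet₂, hX₂, hα₂, hβ₂⟩ := exists_assembly L''
  set P := Fintype.card V₁ + Fintype.card V₂ with hP
  set s' : k := (-1) ^ P with hs'
  have hs'2 : s' ^ 2 = 1 := by rw [hs', ← pow_mul, mul_comm, pow_mul, neg_one_sq, one_pow]
  have hs'0 : s' ≠ 0 := by
    intro h; rw [h] at hs'2; norm_num at hs'2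
  obtain ⟨l, ε, hl0, hε, hll⟩ := hroot (s' * c) (mul_ne_zero hs'0 hc0)
  obtain ⟨X₁, G₁, α₁, hXG₁, hdet₁, hX₁, hα₁, hβ₁⟩ := hbr l hl0
  set κ₁ : k := -c' / (2 * c) with hκ₁
  set κ₂ : k := -1 / (2 * c) with hκ₂
  obtain ⟨β₁, hβ₁c, hw₁⟩ := hβ₁ κ₁
  obtain ⟨β₂, hβ₂c, hw₂⟩ := hβ₂ κ₂
  have hεsq : ε ^ 2 = 1 := by
    rcases hε with h | ⟨h, -⟩ <;> rw [h] <;> norm_num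
  have in1 : ∀ {q}, (p'.2.IsInput q ∨ ∃ e : k, q = C e) → (φ.IsInput q ∨ ∃ e : k, q = C e) :=
    fun h => h.elim (fun h => Or.inl (hin p' (List.mem_cons_of_mem p List.mem_cons_self) _ h))
      Or.inr
  have in2 : ∀ {q}, ((∃ q' ∈ L'', q'.2.IsInput q) ∨ ∃ e : k, q = C e) →
      (φ.IsInput q ∨ ∃ e : k, q = C e) := fun h =>
    h.elim (fun ⟨q', hq', h⟩ => Or.inl (hin q'
      (List.mem_cons_of_mem p (List.mem_cons_of_mem p' hq')) _ h)) Or.inr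
  have ok0 : φ.IsInput (0 : MvPolynomial σ k) ∨ ∃ e : k, (0 : MvPolynomial σ k) = C e :=
    Or.inr ⟨0, (map_zero C).symm⟩
  have hμ : φ.IsInput (MvPolynomial.X i : MvPolynomial σ k) ∨
      ∃ e : k, (MvPolynomial.X i : MvPolynomial σ k) = C e :=
    Or.inl (hin p List.mem_cons_self _ (by rw [hpi]; rfl))
  obtain ⟨N, hN, A, hAsymm, hAent, hAdet⟩ := exists_layout φ
    (Matrix.fromBlocks X₁ 0 0 X₂) (Matrix.fromBlocks G₁ 0 0 G₂)
    (by rw [fromBlocks_multiply]; simp [hXG₁, hXG₂]) (l ^ 2)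
    (by rw [det_fromBlocks_zero₂₁, mul_pow, hdet₁, hdet₂, mul_one])
    (Sum.elim α₁ α₂) (Sum.elim β₁ β₂) (MvPolynomial.X i)
    (forall_fromBlocks (P := fun q => φ.IsInput q ∨ ∃ e : k, q = C e)
      (fun u v => in1 (hX₁ u v)) (fun _ _ => ok0) (fun _ _ => ok0) (fun u v => in2 (hX₂ u v)))
    (forall_sumElim (P := fun q => φ.IsInput q ∨ ∃ e : k, q = C e) (fun v => in1 (hα₁ v))
      (fun v => in2 (hα₂ v)))
    (forall_sumElim (P := fun q => φ.IsInput q ∨ ∃ e : k, q = C e) (fun v => Or.inr (hβ₁c v))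
      (fun v => Or.inr (hβ₂c v)))
    hμ ε (hε.imp id And.left)
  have hPg : P ≤ φ.greenSize := by
    simp only [List.length_cons, List.map_cons, List.sum_cons] at hbud
    have : p'.2.greenSize = 0 := by rw [hpi']; rfl
    omega
  refine ⟨N, ?_, A, hAsymm, hAent, ?_⟩
  · rcases hN with ⟨hN, -⟩ | ⟨hN, hε1⟩
    · left; simp only [Fintype.card_sum] at hN; omega
    · right
      rcases hε with h | ⟨-, hok⟩
      · rw [h] at hε1
        exact absurd (by linear_combination hε1 : (2 : k) = 0) h2
      · simp only [Fintype.card_sum] at hN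
        exact ⟨hok, by omega⟩
  · rw [hAdet, hev, List.map_cons, List.sum_cons, List.map_cons, List.sum_cons, vecMul_fromBlocks,
      Sum.elim_comp_inl, Sum.elim_comp_inr, vecMul_zero, vecMul_zero, add_zero, zero_add,
      sumElim_dotProduct_sumElim, hw₁, hw₂, Fintype.card_sum, ← hP, neg_one_pow_eq_C, ← hs', hpi,
      ArithExpr.eval_var, ← hc, ← hc']
    have h0 : (C ε * (C s' * C (l ^ 2)) : MvPolynomial σ k) = C c := by
      rw [← C_mul, ← C_mul, pow_two, hll, show ε * (s' * (ε * (s' * c))) = ε ^ 2 * s' ^ 2 * c by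
        ring, hεsq, hs'2, one_mul, one_mul]
    have h1 : (C c * (2 * C κ₁) : MvPolynomial σ k) = -C c' := by
      rw [show (2 : MvPolynomial σ k) = C 2 by rw [map_ofNat], ← C_mul, ← C_mul, hκ₁,
        show c * (2 * (-c' / (2 * c))) = -c' by field_simp, C_neg]
    have h2' : (C c * (2 * C κ₂) : MvPolynomial σ k) = -1 := by
      rw [show (2 : MvPolynomial σ k) = C 2 by rw [map_ofNat], ← C_mul, ← C_mul, hκ₂,
        show c * (2 * (-1 / (2 * c))) = -1 by field_simp, C_neg, C_1]
    linear_combination (MvPolynomial.X i - 2 * (C κ₁ * p'.2.eval +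
        C κ₂ * (L''.map fun q => C q.1 * q.2.eval).sum)) * h0 - (p'.2.eval) * h1 -
      ((L''.map fun q => C q.1 * q.2.eval).sum) * h2'

end Final

end Thm3Sharp

end GKKP2011

/-- **GKKP 2011, sharpening of Theorem 3 over `ℂ`** — discharge of the named fact
`GKKP2011_thm3_sharp_complex`: a formula with an addition gate and green size `e` is the
determinant of a symmetric matrix of dimension `≤ 2e+1` whose entries are inputs of the formula
or complex constants. Proof by the merged (`s = t`) layout of `Thm3Sharp.sharp_core`; over `ℂ`
every nonzero constant is a square, so the extra vertex is never needed.
[cite: GrenetEtAl2011, §2.2 (after Thm 3)] -/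
theorem GKKP2011_thm3_sharp_complex_holds : GKKP2011_thm3_sharp_complex := by
  intro σ φ hadd
  have hroot : ∀ c : ℂ, c ≠ 0 → ∃ l ε : ℂ, l ≠ 0 ∧ (ε = 1 ∨ (ε = -1 ∧ False)) ∧ l * l = ε * c := by
    intro c hc
    obtain ⟨z, hz⟩ := IsAlgClosed.exists_eq_mul_self c
    refine ⟨z, 1, fun h => hc ?_, Or.inl rfl, by rw [one_mul, ← hz]⟩
    rw [hz, h, mul_zero]
  obtain ⟨N, hN, A, hA⟩ := GKKP2011.Thm3Sharp.sharp_core False two_ne_zero hroot φ hadd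
  rcases hN with hN | ⟨h, -⟩
  · exact ⟨N, hN, A, hA⟩
  · exact h.elim

/-- **GKKP 2011, sharpening of Theorem 3 over `ℝ`** — discharge of the named fact
`GKKP2011_thm3_sharp_real`: a formula with an addition gate and green size `e` is the
determinant of a symmetric matrix of dimension `≤ 2e+2` whose entries are inputs of the formula
or real constants ("if `k` is the field of real numbers, it is sufficient to add a new vertex
with a loop of weight `-1` … to get the bound `2e+2`"). [cite: GrenetEtAl2011, §2.2 (after Thm 3)] -/
theorem GKKP2011_thm3_sharp_real_holds : GKKP2011_thm3_sharp_real := by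
  intro σ φ hadd
  have hroot : ∀ c : ℝ, c ≠ 0 → ∃ l ε : ℝ, l ≠ 0 ∧ (ε = 1 ∨ (ε = -1 ∧ True)) ∧ l * l = ε * c := by
    intro c hc
    rcases lt_or_gt_of_ne hc with h | h
    · refine ⟨Real.sqrt (-c), -1, ?_, Or.inr ⟨rfl, trivial⟩, ?_⟩
      · exact (Real.sqrt_pos.2 (by linarith)).ne'
      · rw [Real.mul_self_sqrt (by linarith)]; ring
    · refine ⟨Real.sqrt c, 1, (Real.sqrt_pos.2 h).ne', Or.inl rfl, ?_⟩
      rw [Real.mul_self_sqrt h.le, one_mul]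
  obtain ⟨N, hN, A, hA⟩ := GKKP2011.Thm3Sharp.sharp_core True two_ne_zero hroot φ hadd
  refine ⟨N, ?_, A, hA⟩
  rcases hN with hN | ⟨-, hN⟩ <;> omega

end Literature.Computability.AlgebraicComplexity

end
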